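import Literature.Computability.Complexity.StackBricks
import Literature.Computability.Complexity.BranchingFn
import Literature.Computability.Complexity.PairProjections
import Literature.Computability.Complexity.IterateFPGrowth
import HarnessLib

/-!
# Brick algebra: records, projections, one-bit conditions and counted loops of `FP` functions

Trunk `CplxCore`. The tree composes polynomial-time string functions algebraically —
`comp_mem_FP`, the fan-out `fanoutFn f g : z ↦ ⟨f z, g z⟩` (`StringEquality.lean`), the branch
`iteFn c f g` on a computed bit (`BranchingFn.lean`), the projections of `boolUnpair`
(`PairProjections.lean`), clocked iteration (`IterateFP.lean`, `IterateFPGrowth.lean`) — and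
`StackBricks*.lean` supply the arithmetic leaves. This file adds the plumbing a larger machine
(a replay of an oracle algorithm, `Cryptography/ShorStepFP.lean`) is written in:

* **records** `⟨a₀, ⟨a₁, … ⟨aₖ₋₁, aₖ⟩…⟩⟩` (nested `boolPair`, last field bare): the projections
  `nthF i` (field `i`, for `i < k`) and `sndPow i` (the tail after field `i`, so `sndPow (k-1)`
  is the last field), all in `FP`, with the `simp` evaluation rules on `boolPair`;
* **one-bit conditions** `OneBit c` (`c z` is a single bit on *every* input — the format
  `iteFn` needs, and what makes a branch analysable on malformed inputs too): the tests of
  `StackBricks.lean` are one-bit, one-bit is stable under precomposition and under `iteFn` with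
  one-bit branches; `iteFn_of_oneBit`;
* **counted loops** on records `⟨x, ⟨counter, state⟩⟩` with a binary counter:
  `loopStep body` (if the counter is `0` keep, else decrement and replace the state by
  `body z`), its semantics (`loopStep_zero`, `loopStep_succ`, `iterate_loopStep`), the facts
  feeding `iterate_mem_FP_of_growth` (`fstF_loopStep`, `length_loopStep_le`), and
  **`loopFn_mem_FP`**: `z ↦ (loopStep body)^[p |x|] z ∈ FP` for a body in `FP` of linear growth.

## References

* S. Arora, B. Barak, *Computational Complexity: A Modern Approach*, CUP 2009, §1.3 (closure of
  polynomial time under composition and bounded loops), §1.4.1 (clocked simulation).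
-/

namespace Literature.Computability.Complexity

open _root_.Computability

namespace Brick

/-! ### Projections -/

/-- First component of the pair decoder, as a named string function. [folklore] -/
def fstF : List Bool → List Bool := fun z => (boolUnpair z).1

/-- Second component of the pair decoder, as a named string function. [folklore] -/
def sndF : List Bool → List Bool := fun z => (boolUnpair z).2

/-- `fstF ⟨a, b⟩ = a`. [folklore] -/
@[simp] theorem fstF_boolPair (a b : List Bool) : fstF (boolPair a b) = a := by simp [fstF]

/-- `sndF ⟨a, b⟩ = b`. [folklore] -/
@[simp] theorem sndF_boolPair (a b : List Bool) : sndF (boolPair a b) = b := by simp [sndF]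

/-- `fstF ∈ FP`. [folklore] -/
theorem fstF_mem_FP : fstF ∈ FP := boolUnpairFst_mem_FP

/-- `sndF ∈ FP`. [folklore] -/
theorem sndF_mem_FP : sndF ∈ FP := boolUnpairSnd_mem_FP

/-- The parts are short: `2 |fstF z| + |sndF z| ≤ |z|`. [folklore] -/
theorem length_fstF_sndF_le (z : List Bool) : 2 * (fstF z).length + (sndF z).length ≤ z.length :=
  length_boolUnpair_parts_le z

/-- `sndPow i = sndF^[i+1]`: the record after its first `i + 1` fields. [folklore] -/
def sndPow : ℕ → List Bool → List Bool
  | 0 => sndF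
  | i + 1 => sndPow i ∘ sndF

/-- `nthF i = fstF ∘ sndF^[i]`: field `i` of a record. [folklore] -/
def nthF : ℕ → List Bool → List Bool
  | 0 => fstF
  | i + 1 => nthF i ∘ sndF

/-- `sndPow 0 ⟨a, b⟩ = b`. [folklore] -/
@[simp] theorem sndPow_zero_boolPair (a b : List Bool) : sndPow 0 (boolPair a b) = b := by simp [sndPow]

/-- `sndPow (i+1) ⟨a, b⟩ = sndPow i b`. [folklore] -/
@[simp] theorem sndPow_succ_boolPair (i : ℕ) (a b : List Bool) : sndPow (i + 1) (boolPair a b) = sndPow i b := by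
  simp [sndPow]

/-- `nthF 0 ⟨a, b⟩ = a`. [folklore] -/
@[simp] theorem nthF_zero_boolPair (a b : List Bool) : nthF 0 (boolPair a b) = a := by simp [nthF]

/-- `nthF (i+1) ⟨a, b⟩ = nthF i b`. [folklore] -/
@[simp] theorem nthF_succ_boolPair (i : ℕ) (a b : List Bool) : nthF (i + 1) (boolPair a b) = nthF i b := by
  simp [nthF]

/-- `nthF 0 = fstF`. [folklore] -/
@[simp] theorem nthF_zero : nthF 0 = fstF := rfl

/-- `sndPow 0 = sndF`. [folklore] -/
@[simp] theorem sndPow_zero : sndPow 0 = sndF := rfl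

/-- `sndPow i ∈ FP`. [folklore] -/
theorem sndPow_mem_FP : ∀ i : ℕ, sndPow i ∈ FP
  | 0 => sndF_mem_FP
  | i + 1 => comp_mem_FP (sndPow_mem_FP i) sndF_mem_FP

/-- `nthF i ∈ FP`. [folklore] -/
theorem nthF_mem_FP : ∀ i : ℕ, nthF i ∈ FP
  | 0 => fstF_mem_FP
  | i + 1 => comp_mem_FP (nthF_mem_FP i) sndF_mem_FP

/-- Tails shrink: `|sndPow i z| ≤ |z|`. [folklore] -/
theorem length_sndPow_le : ∀ (i : ℕ) (z : List Bool), (sndPow i z).length ≤ z.length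
  | 0, z => by have := length_fstF_sndF_le z; simp; omega
  | i + 1, z => by
    have h1 := length_sndPow_le i (sndF z)
    have h2 := length_fstF_sndF_le z
    simp [sndPow]; omega

/-- Fields are short: `|nthF i z| ≤ |z|`. [folklore] -/
theorem length_nthF_le : ∀ (i : ℕ) (z : List Bool), (nthF i z).length ≤ z.length
  | 0, z => by have := length_fstF_sndF_le z; simp; omega
  | i + 1, z => by
    have h1 := length_nthF_le i (sndF z)
    have h2 := length_fstF_sndF_le z
    simp [nthF]; omega

/-- Field `i + 1` and the tail after it are together within the tail after field `i`:
`2 |nthF (i+1) z| + |sndPow (i+1) z| ≤ |sndPow i z|`. [folklore] -/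
theorem length_nthF_succ_add_sndPow_succ_le : ∀ (i : ℕ) (z : List Bool),
    2 * (nthF (i + 1) z).length + (sndPow (i + 1) z).length ≤ (sndPow i z).length
  | 0, z => by simpa [nthF, sndPow] using length_fstF_sndF_le (sndF z)
  | i + 1, z => by simpa [nthF, sndPow] using length_nthF_succ_add_sndPow_succ_le i (sndF z)

/-! ### One-bit conditions -/

/-- `c` answers with exactly one bit on every input. [folklore] -/
def OneBit (c : List Bool → List Bool) : Prop := ∀ z, ∃ b : Bool, c z = [b]

/-- A one-bit function has one-symbol values. [folklore] -/
theorem OneBit.length_eq {c : List Bool → List Bool} (h : OneBit c) (z : List Bool) : (c z).length = 1 := by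
  obtain ⟨b, hb⟩ := h z; simp [hb]

/-- Precomposition keeps one-bit. [folklore] -/
theorem OneBit.comp {c : List Bool → List Bool} (h : OneBit c) (g : List Bool → List Bool) : OneBit (c ∘ g) :=
  fun z => h (g z)

/-- Constant bits are one-bit. [folklore] -/
theorem oneBit_const (b : Bool) : OneBit (fun _ => [b]) := fun _ => ⟨b, rfl⟩

/-- `isNilFn` is one-bit. [folklore] -/
theorem oneBit_isNilFn : OneBit isNilFn := fun _ => ⟨_, rfl⟩

/-- `parityFn` is one-bit. [folklore] -/
theorem oneBit_parityFn : OneBit parityFn := fun _ => ⟨_, rfl⟩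

/-- `ltFn` is one-bit. [folklore] -/
theorem oneBit_ltFn : OneBit ltFn := fun _ => ⟨_, rfl⟩

/-- `lenLeOneFn` is one-bit. [folklore] -/
theorem oneBit_lenLeOneFn : OneBit lenLeOneFn := fun _ => ⟨_, rfl⟩

/-- `valGeTwoFn` is one-bit. [folklore] -/
theorem oneBit_valGeTwoFn : OneBit valGeTwoFn := fun _ => ⟨_, rfl⟩

/-- **`iteFn` with a one-bit condition is an honest if-then-else on every input.** [folklore] -/
theorem iteFn_of_oneBit {c : List Bool → List Bool} (h : OneBit c) (f g : List Bool → List Bool) (z : List Bool) :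
    iteFn c f g z = if c z = [true] then f z else g z := by
  obtain ⟨b, hb⟩ := h z
  rw [iteFn_apply hb, hb]
  cases b <;> simp

/-- `iteFn` with one-bit condition and one-bit branches is one-bit (for composite conditions:
conjunctions, negations). [folklore] -/
theorem OneBit.ite {c f g : List Bool → List Bool} (hc : OneBit c) (hf : OneBit f) (hg : OneBit g) : OneBit (iteFn c f g) := by
  intro z
  rw [iteFn_of_oneBit hc]
  split_ifs
  · exact hf z
  · exact hg z

/-- Negation of a one-bit condition as an `iteFn`. [folklore] -/
noncomputable def notFn (c : List Bool → List Bool) : List Bool → List Bool := iteFn c (fun _ => [false]) (fun _ => [true])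

/-- `notFn c z = [!b]` when `c z = [b]`. [folklore] -/
theorem notFn_apply {c : List Bool → List Bool} {z : List Bool} {b : Bool} (h : c z = [b]) : notFn c z = [!b] := by
  rw [notFn, iteFn_apply h]; cases b <;> rfl

/-- `notFn` of a one-bit condition is one-bit. [folklore] -/
theorem oneBit_notFn {c : List Bool → List Bool} (h : OneBit c) : OneBit (notFn c) :=
  h.ite (oneBit_const false) (oneBit_const true)

/-- `notFn c ∈ FP`. [folklore] -/
theorem notFn_mem_FP {c : List Bool → List Bool} (h : c ∈ FP) : notFn c ∈ FP :=
  iteFn_mem_FP h (const_mem_FP _) (const_mem_FP _)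

/-- Conjunction of one-bit conditions as an `iteFn`. [folklore] -/
noncomputable def andFn (c d : List Bool → List Bool) : List Bool → List Bool := iteFn c d (fun _ => [false])

/-- `andFn c d z = [b && b']` when `c z = [b]`, `d z = [b']`. [folklore] -/
theorem andFn_apply {c d : List Bool → List Bool} {z : List Bool} {b b' : Bool} (h : c z = [b]) (h' : d z = [b']) :
    andFn c d z = [b && b'] := by
  rw [andFn, iteFn_apply h]; cases b <;> simp [h']

/-- `andFn` of one-bit conditions is one-bit. [folklore] -/
theorem oneBit_andFn {c d : List Bool → List Bool} (hc : OneBit c) (hd : OneBit d) : OneBit (andFn c d) :=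
  hc.ite hd (oneBit_const false)

/-- `andFn c d ∈ FP`. [folklore] -/
theorem andFn_mem_FP {c d : List Bool → List Bool} (hc : c ∈ FP) (hd : d ∈ FP) : andFn c d ∈ FP :=
  iteFn_mem_FP hc hd (const_mem_FP _)

/-! ### Length of fan-outs -/

/-- `|⟨f z, g z⟩| = 2|f z| + |g z| + 2`. [folklore] -/
theorem length_fanoutFn (f g : List Bool → List Bool) (z : List Bool) :
    (fanoutFn f g z).length = 2 * (f z).length + (g z).length + 2 := by
  rw [fanoutFn_apply, length_boolPair]; ring

/-! ### Counted loops with a binary counter -/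

/-- The decrement of the counter field (field `1`): `encodeNat (⟦counter⟧ - 1)`. [folklore] -/
noncomputable def predCntF : List Bool → List Bool := subFn ∘ fanoutFn (nthF 1) (fun _ => [true])

/-- `predCntF ∈ FP`. [folklore] -/
theorem predCntF_mem_FP : predCntF ∈ FP :=
  comp_mem_FP subFn_mem_FP (fanoutFn_mem_FP (nthF_mem_FP 1) (const_mem_FP _))

/-- `predCntF` on a record. [folklore] -/
theorem predCntF_apply (x c s : List Bool) : predCntF (boolPair x (boolPair c s)) = encodeNat (bitsToNat c - 1) := by
  simp [predCntF]

/-- **One round of a counted loop** on records `⟨x, ⟨counter, state⟩⟩`: if the counter is empty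
(`0`), reassemble the record unchanged; otherwise keep `x`, decrement the counter, and replace
the state by `body z` (the body sees the whole record, in particular the counter).
[cite: AroraBarak2009, §1.3 (bounded loops)] -/
noncomputable def loopStep (body : List Bool → List Bool) : List Bool → List Bool :=
  iteFn (isNilFn ∘ nthF 1) (fanoutFn (nthF 0) (fanoutFn (nthF 1) (sndPow 1)))
    (fanoutFn (nthF 0) (fanoutFn predCntF body))

/-- `loopStep body ∈ FP` for `body ∈ FP`. [folklore] -/
theorem loopStep_mem_FP {body : List Bool → List Bool} (h : body ∈ FP) : loopStep body ∈ FP :=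
  iteFn_mem_FP (comp_mem_FP isNilFn_mem_FP (nthF_mem_FP 1))
    (fanoutFn_mem_FP (nthF_mem_FP 0) (fanoutFn_mem_FP (nthF_mem_FP 1) (sndPow_mem_FP 1)))
    (fanoutFn_mem_FP (nthF_mem_FP 0) (fanoutFn_mem_FP predCntF_mem_FP h))

/-- **A finished loop idles**: counter `0`. [folklore] -/
theorem loopStep_zero (body : List Bool → List Bool) (x s : List Bool) :
    loopStep body (boolPair x (boolPair [] s)) = boolPair x (boolPair [] s) := by
  rw [loopStep, iteFn_apply (b := true) (by simp [isNilFn])]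
  simp

/-- **A running loop steps**: counter `k + 1` becomes `k` and the state becomes `body z`.
[folklore] -/
theorem loopStep_succ (body : List Bool → List Bool) (x s : List Bool) (k : ℕ) :
    loopStep body (boolPair x (boolPair (encodeNat (k + 1)) s)) =
      boolPair x (boolPair (encodeNat k) (body (boolPair x (boolPair (encodeNat (k + 1)) s)))) := by
  have hne : encodeNat (k + 1) ≠ [] := by
    intro h
    have := congrArg bitsToNat h
    simp at this
  rw [loopStep, iteFn_apply (b := false) (by simp [isNilFn, hne])]
  simp [predCntF_apply]

/-- The loop keeps the first field, on every input. [folklore] -/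
theorem fstF_loopStep (body : List Bool → List Bool) (z : List Bool) : fstF (loopStep body z) = fstF z := by
  rw [loopStep, iteFn_of_oneBit (oneBit_isNilFn.comp _)]
  split_ifs <;> simp [← nthF_zero]

/-- **Growth of one round**: if `|body z| ≤ |sndPow 1 z| + c (|fstF z| + 1)` on every input, then
`|loopStep body z| ≤ |z| + 4 + c (|fstF z| + 1)`. [folklore] -/
theorem length_loopStep_le {body : List Bool → List Bool} {c : ℕ}
    (hbody : ∀ z, (body z).length ≤ (sndPow 1 z).length + c * ((fstF z).length + 1)) (z : List Bool) :
    (loopStep body z).length ≤ z.length + (c + 4) * ((fstF z).length + 1) := by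
  have h0 := length_fstF_sndF_le z
  have h1 := length_nthF_succ_add_sndPow_succ_le 0 z
  simp only [sndPow_zero] at h1
  rw [loopStep, iteFn_of_oneBit (oneBit_isNilFn.comp _)]
  split_ifs
  · rw [length_fanoutFn, length_fanoutFn]
    simp only [nthF_zero]
    nlinarith
  · rw [length_fanoutFn, length_fanoutFn]
    simp only [nthF_zero]
    have hp : (predCntF z).length ≤ (nthF 1 z).length := by
      have : predCntF z = encodeNat (bitsToNat (nthF 1 z) - 1) := by simp [predCntF]
      rw [this]
      exact (length_encodeNat_mono (Nat.sub_le _ _)).trans (length_encodeNat_bitsToNat_le _)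
    have hb := hbody z
    nlinarith

/-- **Counted loops are in `FP`**: `z ↦ (loopStep body)^[p |fstF z|] z` for `body ∈ FP` of
linear growth in the first field. [cite: AroraBarak2009, §1.3 (bounded loops), §1.4.1] -/
theorem loopFn_mem_FP {body : List Bool → List Bool} (h : body ∈ FP) {c : ℕ}
    (hbody : ∀ z, (body z).length ≤ (sndPow 1 z).length + c * ((fstF z).length + 1)) (p : Polynomial ℕ) :
    (fun z => (loopStep body)^[p.eval (fstF z).length] z) ∈ FP :=
  iterate_mem_FP_of_growth (loopStep_mem_FP h) (c + 4) (fun w => fstF_loopStep body w) (fun w => length_loopStep_le hbody w) p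

/-- The model of a counted loop: from counter `k` and state `s`, run the body `k` times, the
body seeing `⟨x, ⟨counter, state⟩⟩`. [folklore] -/
def loopModel (body : List Bool → List Bool) (x : List Bool) : ℕ → List Bool → List Bool
  | 0, s => s
  | k + 1, s => loopModel body x k (body (boolPair x (boolPair (encodeNat (k + 1)) s)))

/-- **Semantics of the counted loop**: with at least `k` rounds available, the loop started at
counter `k` ends at counter `0` with the model state. [folklore] -/
theorem iterate_loopStep (body : List Bool → List Bool) (x : List Bool) : ∀ (k n : ℕ) (s : List Bool), k ≤ n →
    (loopStep body)^[n] (boolPair x (boolPair (encodeNat k) s)) = boolPair x (boolPair [] (loopModel body x k s))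
  | 0, n, s, _ => by
    have : encodeNat 0 = [] := rfl
    rw [this]
    exact Function.iterate_fixed (loopStep_zero body x s) n
  | k + 1, 0, s, h => by omega
  | k + 1, n + 1, s, h => by
    rw [Function.iterate_succ_apply, loopStep_succ, iterate_loopStep body x k n _ (by omega)]
    rfl

end Brick

end Literature.Computability.Complexity
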